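import Mathlib.Tactic.Linarith
import Mathlib.Tactic.NormNum
import Mathlib.Tactic.Ring
import Mathlib.Tactic.IntervalCases
import Mathlib.Algebra.BigOperators.Group.Finset.Basic
import Mathlib.Data.Nat.Choose.Basic
import HarnessLib

/-!
# The (0,1) cell of the ι-window, XXIX: the product ground `B₁ × B₂`, XVI — the matched node axis of type [τ t]
# (the conductor-meeting tt-class `G`), its hulls `𝒪(W + cG)`, the layer computation, the conductor restriction of `G`,
# the new windows and the match-usage count (report [XXIX]): arithmetic shadows

Family `hodge`, b2b cell `hweil` (helper of item stmt-HodgeConjecture-2524). Report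
`run/shared/lean/b2b/hodge-weil/b2b-hweil-pv1-g41/H2-ZERO-ONE-29.md` ([XXIX]). Continues the companions `…ProductGroundFifteen{,B}.lean` ([XXVIII]).
HONEST FRAMING: census results inside the ladder's H2 test ((0,1) cell) on the SPECIAL fourfold `X₀ = B₁ × B₂`; nothing here is a rung; no case of the
Hodge conjecture is proved; no statement of [Markman 2025] / [Perry 2026] / [EdGFS 2025] is used. Every theorem is a def-free arithmetic identity or
inequality that the report cites at the step named in its docstring; none claims geometry.
-/

-- mandated namespace `Summit.HodgeConjecture.HodgeConjecture.…` (Problem = Summit) trips `linter.dupNamespace`; the lakefile disables it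
-- tree-wide (weak option), restated here so stand-alone elaboration is warning-free too.
set_option linter.dupNamespace false

namespace Summit.HodgeConjecture.HodgeConjecture.WeilTypeLadder

section ProductGroundSixteen

/-- **LEMMA LAY-N ([XXIX] 3.4): the layers of `𝒪(Ŵ + cĜ)` on the [τ t] node axis.** On `P̂₊₊ = Bl₂(Θ̃_y × Θ̃_x)` one has
`(Ŵ + kĜ)|_{P̂₊₊} ≡ (3 − k)F₁ + (3 − 2k)F₂ + 2k(C*₊ + C*₋)` (normal bundle `−F₁ − 2F₂ + ΣC*`: `Θ̃_y² = 2 − 3 = −1`, `Θ̃_x² = 2 − 4 = −2`); GRR for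
`Θ_y × Θ_x ⊂ X₀` gives curve classes `(d₁ − 1, d₂ − 1)` and `χ = (d₁ − 1)(d₂ − 1)`; the surface blow-down formula costs `C(2k, 2)` per blown-up point
(two of them); the two exceptional curves carry `𝒪(−2k)` (`χ = 1 − 2k` each). Hence the `k`-th layer has point entry
`2(2−k)(2−2k) − 4·C(2k,2) − 2(1−2k)`, curve entries `(2(2−k), 2(2−2k))`: at `k = 1`: `(2, 0; −2)`, at `k = 0`: `(4, 4; 6)`, at `k = −1`: `(6, 8; 6)`; so
`𝒪(Ŵ + Ĝ) − 𝒪(Ŵ)` is `2θ₁θ₂ + (2, 0) − 2pt` and `𝒪(Ŵ − Ĝ) − 𝒪(Ŵ)` is `−2θ₁θ₂ − (4, 4) − 6pt`. Independent Riemann–Roch check of the `k = 1` layer on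
`Bl₂(C₁ × C₂)` (`C_i` of genus 2): `L = 2F₁ + F₂ + 2E₁ + 2E₂`, `L² = 4 − 8 = −4`, `L·K = 6 − 4 = 2`, `χ(L) = 1 + (L² − L·K)/2 = −2` per component, and
`2·(−2) − 2·(−1) = −2`. [`norm_num`] -/
theorem pg16_layers :
    ((2:ℤ) - 3 = -1 ∧ (2:ℤ) - 4 = -2) ∧
    (∀ d₁ d₂ : ℤ, d₁ * d₂ - (d₁ + d₂) + 1 = (d₁ - 1) * (d₂ - 1)) ∧
    (2 * (2 - 1) * (2 - 2 * 1) - 4 * (2 * 1 * (2 * 1 - 1) / 2) - 2 * (1 - 2 * 1) = (-2:ℤ) ∧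
     2 * (2 - 0) * (2 - 2 * 0) - 4 * (2 * 0 * (2 * 0 - 1) / 2) - 2 * (1 - 2 * 0) = (6:ℤ) ∧
     2 * (2 - (-1)) * (2 - 2 * (-1)) - 4 * (2 * (-1) * (2 * (-1) - 1) / 2) - 2 * (1 - 2 * (-1)) = (6:ℤ)) ∧
    ((2 * (2 - 1) = (2:ℤ) ∧ 2 * (2 - 2 * 1) = (0:ℤ)) ∧ (2 * (2 - 0) = (4:ℤ) ∧ 2 * (2 - 2 * 0) = (4:ℤ))) ∧
    ((1:ℚ) + ((-4) - 2) / 2 = -2 ∧ (2:ℤ) * 2 * 1 + 4 * (-1) = -4 + 4 ∧ 2 * (-2) - 2 * (-1) = (-2:ℤ)) := by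
  refine ⟨by norm_num, fun d₁ d₂ => by ring, by norm_num, by norm_num, by norm_num⟩

/-- **LEMMA CS2^G, the B₂ side ([XXIX] 3.3 (e); = [XXV] PROPOSITION TT (c) on the node axis).** With `a₁ + a₂ + c = 3` the `(θ₁, pt₂)` entry of the hull
`𝒪(W + cG)` is `β(c) = 2a₂² − 6a₂ + 8 − 2c² − Sh2`, `Sh2 = 2Σ_j y_j²`, on the B₂ pair values with `Σ_j y_j = 3 − 2a₂`; it is the horizontal class of the
cosupport, so `β(c) ≥ 0`. Cauchy–Schwarz with four terms, `4Σy² − (Σy)² = Σ_{i<j}(y_i − y_j)² ≥ 0`, gives `2c² + β ≤ 7/2`, hence `c² ≤ 1`; and for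
`c = ±1`, `0 ≤ β ≤ 1` with `β` even forces `β = 0` (no horizontal cosupport: `u_cos = 0`). [`nlinarith` / `omega`] -/
theorem pg16_B2_side (a c y₁ y₂ y₃ y₄ : ℤ) (hs : y₁ + y₂ + y₃ + y₄ = 3 - 2 * a)
    (hβ : 0 ≤ 2 * a ^ 2 - 6 * a + 8 - 2 * c ^ 2 - 2 * (y₁ ^ 2 + y₂ ^ 2 + y₃ ^ 2 + y₄ ^ 2)) :
    c ^ 2 ≤ 1 ∧ ((c = 1 ∨ c = -1) → 2 * a ^ 2 - 6 * a + 8 - 2 * c ^ 2 - 2 * (y₁ ^ 2 + y₂ ^ 2 + y₃ ^ 2 + y₄ ^ 2) = 0) := by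
  have hcs : (y₁ + y₂ + y₃ + y₄) ^ 2 ≤ 4 * (y₁ ^ 2 + y₂ ^ 2 + y₃ ^ 2 + y₄ ^ 2) := by
    nlinarith [sq_nonneg (y₁ - y₂), sq_nonneg (y₁ - y₃), sq_nonneg (y₁ - y₄), sq_nonneg (y₂ - y₃), sq_nonneg (y₂ - y₄), sq_nonneg (y₃ - y₄)]
  rw [hs] at hcs
  have h1 : 4 * c ^ 2 + 2 * (2 * a ^ 2 - 6 * a + 8 - 2 * c ^ 2 - 2 * (y₁ ^ 2 + y₂ ^ 2 + y₃ ^ 2 + y₄ ^ 2)) ≤ 7 := by nlinarith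
  refine ⟨by nlinarith [sq_nonneg c], fun hc => ?_⟩
  rcases hc with hc | hc <;> subst hc <;> omega

/-- **LEMMA CS2-N^G, the B₁ side ([XXIX] 3.5).** With `a₂ = 3 − a₁ − c` the `(pt₁, θ₂)` entry of the hull `𝒪(W + cG)` is
`E₁^{(c)} = E₁ − c²`, `E₁ = 2a₁² − 7a₁ + 9 − v_w(v_w+1) − 2(x₃² + x₄²)` on the plane `v_w + x₃ + x₄ = 3 − 2a₁` ([XXVII] 14.3; the box contributes
`E₁ − 3c`, the layers `3c − c²`), and PIN-N's inequality `E₁^{(c)} ≥ 2m + n₀ − 2 ≥ 1 − a₁ − v_w` (`m = a₂ − v_w + c − n₀ ≥ 0`, `n₀ ≤ a₂ − v_w + c`) reads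
`v_w² + 2x₃² + 2x₄² ≤ 2a₁² − 6a₁ + 8 − c²`. For `c = ±1` (right side `2a₁² − 6a₁ + 7`): at `a₁ = 1` the integer solutions are exactly
`(1,0,0), (0,1,0), (0,0,1)`, at `a₁ = 2` exactly `(−1,0,0), (0,−1,0), (0,0,−1)` — the same three as for `c = 0` ([XXVII] 14.6), so modulo the fibre
relation and `p₃ ↔ p₄` the hull `𝒪(W + cG)` is one of FOUR types for each `c ∈ {−1, 0, 1}`. Also: `3c − c² − 3c = −c²` and `1 − a₁ − v_w` is what
`2(a₂ − v_w + c) − (a₂ − v_w + c) − 2` becomes at `a₂ = 3 − a₁ − c`. [`nlinarith` / `interval_cases` / `omega` / `ring`] -/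
theorem pg16_B1_side :
    (∀ a₁ c v : ℤ, 2 * ((3 - a₁ - c) - v + c) - ((3 - a₁ - c) - v + c) - 2 = 1 - a₁ - v) ∧ (∀ c : ℤ, 3 * c - c ^ 2 - 3 * c = -c ^ 2) ∧
    (∀ v x₃ x₄ : ℤ, v + x₃ + x₄ = 3 - 2 * 1 → v ^ 2 + 2 * x₃ ^ 2 + 2 * x₄ ^ 2 ≤ 2 * 1 ^ 2 - 6 * 1 + 7 →
      (v, x₃, x₄) = (1, 0, 0) ∨ (v, x₃, x₄) = (0, 1, 0) ∨ (v, x₃, x₄) = (0, 0, 1)) ∧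
    (∀ v x₃ x₄ : ℤ, v + x₃ + x₄ = 3 - 2 * 2 → v ^ 2 + 2 * x₃ ^ 2 + 2 * x₄ ^ 2 ≤ 2 * 2 ^ 2 - 6 * 2 + 7 →
      (v, x₃, x₄) = (-1, 0, 0) ∨ (v, x₃, x₄) = (0, -1, 0) ∨ (v, x₃, x₄) = (0, 0, -1)) := by
  refine ⟨fun a₁ c v => by ring, fun c => by ring, fun v x₃ x₄ hs hq => ?_, fun v x₃ x₄ hs hq => ?_⟩
  · have hv1 : v ≤ 1 := by nlinarith [sq_nonneg x₃, sq_nonneg x₄]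
    have hv2 : -1 ≤ v := by nlinarith [sq_nonneg x₃, sq_nonneg x₄]
    have h31 : x₃ ≤ 1 := by nlinarith [sq_nonneg v, sq_nonneg x₄]
    have h32 : -1 ≤ x₃ := by nlinarith [sq_nonneg v, sq_nonneg x₄]
    have h41 : x₄ ≤ 1 := by nlinarith [sq_nonneg v, sq_nonneg x₃]
    have h42 : -1 ≤ x₄ := by nlinarith [sq_nonneg v, sq_nonneg x₃]
    interval_cases v <;> interval_cases x₃ <;> interval_cases x₄ <;> simp_all
  · have hv1 : v ≤ 1 := by nlinarith [sq_nonneg x₃, sq_nonneg x₄]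
    have hv2 : -1 ≤ v := by nlinarith [sq_nonneg x₃, sq_nonneg x₄]
    have h31 : x₃ ≤ 1 := by nlinarith [sq_nonneg v, sq_nonneg x₄]
    have h32 : -1 ≤ x₃ := by nlinarith [sq_nonneg v, sq_nonneg x₄]
    have h41 : x₄ ≤ 1 := by nlinarith [sq_nonneg v, sq_nonneg x₃]
    have h42 : -1 ≤ x₄ := by nlinarith [sq_nonneg v, sq_nonneg x₃]
    interval_cases v <;> interval_cases x₃ <;> interval_cases x₄ <;> simp_all

/-- **LEMMA CRG ([XXIX] 3.2): the conductor restriction of `𝒪(cG)` at the two new `A₁` points `P*_± = (ρ₁, ±m)` of the conductor.** On the cone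
`A = ℂ[a,c,d]/(a² − cd)` (`s : a ↦ −a`, invariants `ℂ[c,d] = 𝒪_{B₂}`) the torsion-free restriction of `𝒪(cG)` is `𝔪^{|c|}` times the local generator of
its hull `𝒪(cη_{ρ₁})` (`η_{ρ₁} = div(a)` is Cartier there): colength `Σ_{k<|c|} dim(𝔪^k/𝔪^{k+1}) = Σ_{k<|c|}(2k+1) = c²`; the invariant part has colength
`#{monomials of ℂ[c,d] of degree < |c|} = |c|(|c|+1)/2`; so `μ(P*) = c² − |c|(|c|+1)/2` vanishes for `|c| ≤ 1` (the forced `W₀`-point at `(w, ±m)`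
cancels the cotorsion, exactly as RES-N (e) at the `P_q`) and equals `1` at `|c| = 2`. Numerically: `Σ_{k<1}(2k+1) = 1 = 1·2/2`, `Σ_{k<2}(2k+1) = 4`,
`2·3/2 = 3`, `4 − 3 = 1`. [`decide` / `norm_num`] -/
theorem pg16_conductor_restriction_G :
    (∀ n : ℕ, n ≤ 6 → (Finset.range n).sum (fun k => 2 * k + 1) = n ^ 2) ∧
    ((1:ℤ) ^ 2 - 1 * (1 + 1) / 2 = 0 ∧ (0:ℤ) ^ 2 - 0 * (0 + 1) / 2 = 0 ∧ (2:ℤ) ^ 2 - 2 * (2 + 1) / 2 = 1) := by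
  refine ⟨fun n hn => ?_, by norm_num⟩
  interval_cases n <;> decide

/-- **PROPOSITION PQ-N^G ([XXIX] 4.1): the windows and the net budget for the hulls `𝒪(W ± G)`.** (E^G): `v′ + τ′ = c_E^{(c)} + n₀` with
`c_E^{(c)} = E₁ − c² + 2 − 2a₂ + 2v_w − 2c` at `a₂ = 3 − a₁ − c`; for `c = 1` and the four types `(a₁, v_w; E₁) = (1,1;2), (1,0;2), (2,−1;3), (2,0;1)` this is
`1, −1, 0, 0` (for `c = 0`: `2, 0, 1, 1`, [XXVIII] 4.1 (b)). (B^G): the `(pt₁,pt₂)` entry of `R ĝ_* 𝒪(Ŵ + cĜ)` is `E₁ − 3c + (layers)`, i.e. `E₁ − 5` for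
`c = 1` and `E₁ − 3` for `c = −1`; the two new ordinary double points carry `R¹` of length `C(2c+1, 3)` each (`1` for `c = 1`, `0` for `c = −1`), so the
budget identity NET of the new points reads `χ(Q_G) − Σ_{P_q, old ODP} R¹ + c_P + χ(𝒢) = (E₁ − 5) + 2 + 2 = (E₁ − 3) + 2 + 0 = E₁ − 1` for `c = ±1`
(`E₁ + 2` for `c = 0`): net budgets `1, 1, 2, 0` on the four types. The windows (`m = a₂ − v_w + c − n₀ ≥ 0`, `c_E^{(c)} + n₀ ≥ 0`) for `c = 1`:
`n₀ ∈ {−1,0,1}` (`W_w+G`, `a₂ = 1`), `{1,2}` (`W₀+G`), `{0,1,2}` (`W_w′+G`, `a₂ = 0`), `{0,1}` (`W₀′+G`). [`norm_num` / `omega`] -/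
theorem pg16_windows_budget :
    ((2:ℤ) - 1 + 2 - 2 * 1 + 2 * 1 - 2 = 1 ∧ (2:ℤ) - 1 + 2 - 2 * 1 + 2 * 0 - 2 = -1 ∧ (3:ℤ) - 1 + 2 - 2 * 0 + 2 * (-1) - 2 = 0 ∧
      (1:ℤ) - 1 + 2 - 2 * 0 + 2 * 0 - 2 = 0) ∧
    ((2:ℤ) + 2 - 2 * 2 + 2 * 1 = 2 ∧ (2:ℤ) + 2 - 2 * 2 + 0 = 0 ∧ (3:ℤ) + 2 - 2 * 1 - 2 = 1 ∧ (1:ℤ) + 2 - 2 * 1 + 0 = 1) ∧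
    (Nat.choose (2 * 1 + 1) 3 = 1 ∧ Nat.choose 1 3 = 0 ∧ ∀ E : ℤ, (E - 5) + 2 + 2 = E - 1 ∧ (E - 3) + 2 + 0 = E - 1) ∧
    ((2:ℤ) - 1 = 1 ∧ (3:ℤ) - 1 = 2 ∧ (1:ℤ) - 1 = 0) ∧
    ((∀ n₀ : ℤ, (0 ≤ 1 - 1 + 1 - n₀ ∧ 0 ≤ 1 + n₀) ↔ (-1 ≤ n₀ ∧ n₀ ≤ 1)) ∧ (∀ n₀ : ℤ, (0 ≤ 1 - 0 + 1 - n₀ ∧ 0 ≤ -1 + n₀) ↔ (1 ≤ n₀ ∧ n₀ ≤ 2)) ∧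
     (∀ n₀ : ℤ, (0 ≤ 0 - (-1) + 1 - n₀ ∧ 0 ≤ 0 + n₀) ↔ (0 ≤ n₀ ∧ n₀ ≤ 2)) ∧ (∀ n₀ : ℤ, (0 ≤ 0 - 0 + 1 - n₀ ∧ 0 ≤ 0 + n₀) ↔ (0 ≤ n₀ ∧ n₀ ≤ 1))) := by
  refine ⟨by norm_num, by norm_num, ⟨by decide, by decide, fun E => by omega⟩, by norm_num, ?_⟩
  refine ⟨fun n₀ => by omega, fun n₀ => by omega, fun n₀ => by omega, fun n₀ => by omega⟩

/-- **THE [τ t] LOCAL DEGREES ([XXIX] 2.2 / 4.1 (d)).** `Ĝ·ℓ_q = 1` at all eight `P_q` (every base point of `ℓ₂` lies on exactly one of `Θ_{±x}`), so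
`d_q = −v_w − 2h_q + c`; for `c = 1` the four types have `(d_{q₀}, d_other) = (−2, 0), (−1, 1), (2, 0), (1, −1)` (from `(v_w, h_{q₀}, h_other) =
(1, 1, 0), (0, 1, 0), (−1, 0, 1), (0, 0, 1)`), and the parity `d_q ≡ c_q` at the `P_q` makes the number of conductor fibres `≡ v_w + c (mod 2)`:
EVEN for `W_w + G` (where `W_w` needed an odd number) and ODD for `W₀′ + G`. The old ordinary double points: degree `−(x_p + y_q) + c·δ_{pq}`,
length `C(x_p + y_q − cδ_{pq} + 1, 3)`; the only non-zero instance among the `c = ±1` types is `x_p + y_q = 2`, `δ = 0`, `c = 1` (type `W₀ + G`: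
`x₃ = 1` against the special pair `h_{q₀} = 1`): `C(3,3) = 1` at two points, total `2`. [`norm_num` / `decide` / `omega`] -/
theorem pg16_local_degrees :
    ((-(1:ℤ) - 2 * 1 + 1 = -2 ∧ -(1:ℤ) - 2 * 0 + 1 = 0) ∧ (-(0:ℤ) - 2 * 1 + 1 = -1 ∧ -(0:ℤ) - 2 * 0 + 1 = 1) ∧
     (-(-1:ℤ) - 2 * 0 + 1 = 2 ∧ -(-1:ℤ) - 2 * 1 + 1 = 0) ∧ (-(0:ℤ) - 2 * 0 + 1 = 1 ∧ -(0:ℤ) - 2 * 1 + 1 = -1)) ∧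
    (∀ v c nf : ℤ, (v + c - nf) % 2 = 0 ↔ (nf - (v + c)) % 2 = 0) ∧ (((1:ℤ) + 1) % 2 = 0 ∧ ((0:ℤ) + 1) % 2 = 1) ∧
    (Nat.choose (1 + 1 - 0 + 1) 3 = 1 ∧ Nat.choose (1 + 1 - 1 + 1) 3 = 0 ∧ 2 * Nat.choose 3 3 = 2) := by
  refine ⟨by norm_num, fun v c nf => by omega, by norm_num, by decide⟩

/-- **EXAMPLES G1, G2, G3 ([XXIX] 5.3): the new hull classes are POPULATED (bookkeeping lines of the exact rows).**
G1 (hull `W₀′ + G`, net budget `0`, `n₀ = 0`, `Δ̃ = η_x` one conductor fibre, maximal gluing, no `Z′`): `χ(η_x) + (n₀−2)² − ΣR1 = 2 + 4 − 6 = 0`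
(`R1(−1; 1, 0) = 1` at the six `P_q` off the special pair, `R1(1; 1, 0) = 0` at `P_{±q₀}`); window `v′ + τ′ = 0 + 0`; `m = 0 − 0 + 1 − 0 = 1`.
G2 (hull `W_w′ + G`, net budget `2`, `n₀ = 2`, no conductor curve, `Z′ = (α) = {w₁} × D̃` of `χ = 2`): `2 + 0 − 0 = 2`; `m = 0 + 1 + 1 − 2 = 0`;
window `2 + 0 = 0 + 2`. G3 (hull `W_w + G`, net budget `1`, `n₀ = 1`, no conductor curve, `Z′ = (α)`): `2 + 1 − 2 = 1` (`λ(−2) = 1` at `P_{±q₀}`);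
`m = 1 − 1 + 1 − 1 = 0`, fibre parity `1 + 1 ≡ 0`; window `2 + 0 = 1 + 1`. Independent check of `ch₄` for G2: `(E₁ − 5) − χ(Q) + ℓ(R¹) − c_P − χ(𝒢) =
(3 − 5) − 2 + 2 − 0 − 0 = −2`, and for G1: `(1 − 5) − 2 + (2 + 6) − 0 − 4 = −2`. [`norm_num`] -/
theorem pg16_examples_G :
    ((2:ℤ) + (0 - 2) ^ 2 - 6 * 1 = 0 ∧ (0:ℤ) - 0 + 1 - 0 = 1) ∧
    ((2:ℤ) + (2 - 2) ^ 2 - 0 = 2 ∧ (0:ℤ) + 1 + 1 - 2 = 0 ∧ (2:ℤ) + 0 = 0 + 2) ∧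
    ((2:ℤ) + (1 - 2) ^ 2 - 2 * 1 = 1 ∧ (1:ℤ) - 1 + 1 - 1 = 0 ∧ ((1:ℤ) + 1) % 2 = 0 ∧ (2:ℤ) + 0 = 1 + 1) ∧
    (((3:ℤ) - 5) - 2 + 2 - 0 - 0 = -2 ∧ ((1:ℤ) - 5) - 2 + (2 + 6) - 0 - 4 = -2) := by
  refine ⟨by norm_num, by norm_num, by norm_num, by norm_num⟩

/-- **PROPOSITION N-X3 / THEOREM N* ([XXIX] 6.2–6.4): the transport counts.** [τ t]: the matched stratum has dimension `9 − 1 = 8`, FZ has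
`20 − 1 = 19 ≥ 1` unmatched critical values of `ℓ₂`, a row uses at most `3 + 1` further conditions (USE-N's three — thetas carrying base pairs
`≤ m ≤ 2` for the `G`-classes, no diagonal since `u_cos = 0` — plus one incidence), so `e₁^ι ≥ 8 − 4 = 4 ≥ 2`; with `k ≤ 3` matches of any of the four
types `e₁^ι ≥ 9 − k − 4 ≥ 2`. N*: every enumerated row uses, beyond its couplings, at most `2` (τ-created points) `+ 1 + 1` (an `(α)` and a `Z_H` at
nodal match points) `+ ⌊DEFICIT/4⌋` (fillers of length `≥ 4` at fixed match points) matches, minus its incidence-proof parameters; the script's maximum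
over the `342` realisable row types on the [τ t] support (`411 − 69`; `351 − 61 = 290` on an unmatched support) is `NET = 6`, so `e₁^ι ≥ 9 − 6 = 3 ≥ 2` whatever the matching pattern (`k ≤ 17 < 20` keeps FZ's step (d1)). Two
distinct symmetric thetas through one non-torsion base pair would meet in `2 + 2 = 4 > 2 = θ²` points: impossible (the `61` doubled-theta row types
of [XXVIII] §5 are non-reduced structures). The filler lemma's count: a length-`ℓ` punctual scheme at a non-fixed point of the support, `ℓ ≤ 5 ≤ 7`,
has `dim Hom_Σ(J, 𝒪_ξ) ≥ 4ℓ − ℓ = 3ℓ ≥ 3`; a length-2 quotient at a point of embedding dimension `4` has a `ℙ³` of choices (`4 − 1 = 3` parameters).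
[`norm_num` / `omega`] -/
theorem pg16_transport_counts :
    ((9:ℤ) - 1 = 8 ∧ (20:ℤ) - 1 = 19 ∧ (3:ℤ) + 1 = 4 ∧ (8:ℤ) - 4 = 4 ∧ (2:ℤ) ≤ 4) ∧ (∀ k : ℤ, k ≤ 3 → 2 ≤ 9 - k - 4) ∧
    ((2:ℤ) + 1 + 1 = 4 ∧ (9:ℤ) - 6 = 3 ∧ (2:ℤ) ≤ 3 ∧ (17:ℤ) < 20 ∧ (351:ℤ) - 61 = 290 ∧ (411:ℤ) - 69 = 342) ∧
    ((2:ℤ) + 2 = 4 ∧ (2:ℤ) < 4) ∧ (∀ l : ℤ, 1 ≤ l → l ≤ 7 → 3 ≤ 4 * l - l) ∧ ((4:ℤ) - 1 = 3) := by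
  refine ⟨by norm_num, fun k hk => by omega, by norm_num, by norm_num, fun l h1 _ => by omega, by norm_num⟩

end ProductGroundSixteen

end Summit.HodgeConjecture.HodgeConjecture.WeilTypeLadder
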